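import Mathlib
import HarnessLib
import Literature.Analysis.FluidPDE.CurlFreeLiouville
import Literature.Analysis.FluidPDE.TaoEnstrophyLocalisation
import Summits.NavierStokesRegularity.NavierStokesRegularity.Theorems.LocalSineTubeDoorEnstrophyProductionProfileRigidity
import Summits.NavierStokesRegularity.NavierStokesRegularity.Theorems.PoloidalWindowDoorPoloidalWindowRigidityVorticityTranslate
import Summits.NavierStokesRegularity.NavierStokesRegularity.Theorems.PoloidalWindowDoorPoloidalWindowRigidityStrainRate
import Summits.NavierStokesRegularity.NavierStokesRegularity.Theorems.PoloidalWindowDoorPoloidalWindowRigidityVerticalMean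

/-!
# K2 `PoloidalWindowRigidity` (stmt-NavierStokesRegularity-19708), residue (G″): THE VERTICALLY PERIODIC STRATUM IS
# EMPTY (CENSUS-K2G §16.3, mechanism M9; K2 lead nsreg-p7 gen 4)

**A profile of the route's Type-I class that is poloidal along `e₃` (`⟪curl v, e₃⟫ ≡ 0`) and periodic in the vertical
direction (`v(t, x + L e₃) = v(t, x)`, `L > 0`) is identically zero** (`eq_zero_of_vertical_period`).

Proof (M9 = enstrophy Gronwall from `t = −∞`).  (1) The vertical mean `v̄ = (1/L)∫₀ᴸ v(· + z e₃) dz` of a slice is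
`z`-independent, bounded, and its horizontal projection `V = v̄ − ⟪v̄, e₃⟫e₃` is curl-free (`(curl V)₃ = mean of
`ω₃ = 0`, the other components are `z`-derivatives) and divergence-free (`div V = mean of div v − ∂₃v̄₃ = 0`), hence
CONSTANT (tree `eq_of_curl_eq_zero_of_isDivFree_of_bounded`, KNSS Lemma 3.1's Liouville step): the mean horizontal
flow is rigid, `∇ v̄_h ≡ 0` on horizontal vectors.  (2) Hence the horizontal block of `Dv` is a pure fluctuation:
`⟪Dv(t,y) a, a⟫ = ⟪(Dv(t,y) − Dv̄(t,y)) a, a⟫` for horizontal `a`, and `‖Dv − Dv̄‖ ≤ L sup‖D²v(t)‖ ≤ L C₃ (−t)^{−3/2}`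
(Poincaré along a vertical period; scale-sharp second-derivative rate of the class, `exists_iteratedFDeriv_two_rate_of_class`,
KNSS 2009 Prop. 4.1 with `k = 2`).  (3) For a poloidal profile the enstrophy production is `⟪ω, Dv ω⟫` with `ω`
horizontal, so `⟪ω, Dv ω⟫ ≤ L C₃ (−t)^{−3/2} |ω|²` — an INTEGRABLE rate at `−∞`; the weight
`g(t) = exp(−4 L C₃/√(−t))` absorbs it and the weighted maximum principle of the companion mechanism
(companion file `…StrainRate`, `curl_eq_zero_of_weighted_production`) gives `curl v ≡ 0`, whence
`v ≡ 0` (tree `…Degenerate.eq_zero_of_irrotational`).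

Corollary: the HELICAL stratum S1 of the line `slicesharp-screw` (screw-invariant profiles, pitch `κ ≠ 0`; tree
`…ScrewAssembly`, ≈ 1 400 lines over L2/L3/L4/L4a) is the special case `L = 2π/|κ|` — not re-derived here.

Inputs NOT used: the frozen constraint, the Clebsch potentials, the pressure; the Oseen identity enters only through the
class facts (smoothness, rates) and `eq_zero_of_irrotational` — consistent with refuter1's parasitic drift
`c(t)e₃` (poloidal, vertically periodic, irrotational, killed exactly at that last step; tree `…/Negative/FalseWithoutMild`).

WHAT THIS IS NOT: not a proof of K2 and nothing about Clay (A) — one more settled stratum of the residue of crux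
`PoloidalWindowRigidity` (bears_on LADDER-NS N0, route PoloidalWindowDoor).
-/

noncomputable section

-- the summit and its single sub-problem share the name (CONVENTIONS §1), as in every Theorems file
set_option linter.dupNamespace false

namespace Summit.NavierStokesRegularity.NavierStokesRegularity.Theorems.PoloidalWindowDoorPoloidalWindowRigidityVerticalPeriod

open MeasureTheory Set Function Filter Topology TopologicalSpace Metric InnerProductSpace intervalIntegral
open scoped RealInnerProductSpace InnerProductSpace Laplacian ContDiff ENNReal Interval
open Literature.Analysis Literature.Analysis.FluidPDE
open Summit.NavierStokesRegularity.NavierStokesRegularity.Theorems.LocalSineTubeDoorProfileAlignedWindowRigidityAncient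
open Summit.NavierStokesRegularity.NavierStokesRegularity.Theorems.PoloidalWindowDoorPoloidalWindowRigidityWindow
open Summit.NavierStokesRegularity.NavierStokesRegularity.Theorems.PoloidalWindowDoorPoloidalWindowRigidityDegenerate
open Summit.NavierStokesRegularity.NavierStokesRegularity.Theorems.PoloidalWindowDoorPoloidalWindowRigidityClassRate
open Summit.NavierStokesRegularity.NavierStokesRegularity.Theorems.LocalSineTubeDoorBoundedSubsolutionMaxPrinciple
open Summit.NavierStokesRegularity.NavierStokesRegularity.Theorems.LocalSineTubeDoorEnstrophyProductionProfileRigidity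
open Summit.NavierStokesRegularity.NavierStokesRegularity.Theorems.PoloidalWindowDoorPoloidalWindowRigidityVerticalMean

variable {C : ℝ} {v : ℝ → EuclideanSpace ℝ (Fin 3) → EuclideanSpace ℝ (Fin 3)}

/-! ### the stratum: vertically periodic poloidal profiles -/

/-- **The enstrophy production of a vertically periodic poloidal profile has an integrable rate**:
`⟪ω, Dv(s,y) ω⟫ ≤ L C₃/((−s)√(−s)) · |ω|²`, with `C₃` the Hessian rate of the class. -/
theorem production_le_of_vertical_period (hrate : HasTypeITimeDecay C v)
    (hcont : ContinuousOn (uncurry v) (Iio (0 : ℝ) ×ˢ univ))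
    (hmild : ∀ s t : ℝ, s < t → t < 0 → ∀ x,
      v t x = UnboundedOperators.heatExtension (v s) (t - s) x - oseenDuhamel 1 s v v t x)
    (hdiv : ∀ t < 0, VectorCalculus.IsDivFree (v t))
    (hpol : ∀ s < 0, ∀ y, ⟪curl (v s) y, EuclideanSpace.single 2 (1 : ℝ)⟫_ℝ = 0)
    {L : ℝ} (hL : 0 < L) (hper : ∀ s < 0, ∀ y, v s (y + L • EuclideanSpace.single 2 (1 : ℝ)) = v s y)
    {C₃ : ℝ} (hC₃ : ∀ t < 0, ∀ y, ‖iteratedFDeriv ℝ 2 (v t) y‖ ≤ C₃ / ((-t) * Real.sqrt (-t)))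
    {s : ℝ} (hs : s < 0) (y : EuclideanSpace ℝ (Fin 3)) :
    ⟪curl (v s) y, fderiv ℝ (v s) y (curl (v s) y)⟫_ℝ ≤
      L * C₃ / ((-s) * Real.sqrt (-s)) * ⟪curl (v s) y, curl (v s) y⟫_ℝ := by
  set e₃ : EuclideanSpace ℝ (Fin 3) := EuclideanSpace.single 2 (1 : ℝ) with he₃
  obtain ⟨C₁, hC₁⟩ := exists_fderiv_rate_of_class hrate hcont hmild
  have hsm : ContDiff ℝ 2 (v s) := (analyticOnNhd_slice hcont (bdd_of_hasTypeITimeDecay hrate) hmild hs).contDiff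
  have hDu1 : ContDiff ℝ 1 (fderiv ℝ (v s)) := hsm.fderiv_right le_rfl
  have hB₀ : ∀ y, ‖v s y‖ ≤ C / Real.sqrt (-s) := fun y => hrate s hs y
  have hB₁ : ∀ y, ‖fderiv ℝ (v s) y‖ ≤ C₁ / (-s) := fun y => hC₁ s hs y
  have hB₂ : ∀ y, ‖fderiv ℝ (fderiv ℝ (v s)) y‖ ≤ C₃ / ((-s) * Real.sqrt (-s)) := fun y => by
    rw [← norm_iteratedFDeriv_one (𝕜 := ℝ), norm_iteratedFDeriv_fderiv]
    exact hC₃ s hs y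
  set Ω : EuclideanSpace ℝ (Fin 3) := curl (v s) y with hΩ
  set D : EuclideanSpace ℝ (Fin 3) →L[ℝ] EuclideanSpace ℝ (Fin 3) := fderiv ℝ (v s) y with hD
  set DI : EuclideanSpace ℝ (Fin 3) →L[ℝ] EuclideanSpace ℝ (Fin 3) :=
    ∫ z in (0:ℝ)..L, fderiv ℝ (v s) (y + z • e₃) with hDI
  -- the mean gradient is vertical on `Ω`
  have hmean : ⟪DI Ω, Ω⟫_ℝ = 0 :=
    inner_verticalMeanGradient_eq_zero hsm hB₀ hB₁ hB₂ (hdiv s hs) (hpol s hs) L (hper s hs) y Ω Ω (hpol s hs y)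
  -- the deviation from the mean is small
  have hdev : ‖D - (1 / L) • DI‖ ≤ L * ‖e₃‖ * (C₃ / ((-s) * Real.sqrt (-s))) :=
    norm_sub_verticalAverage_le hDu1 hB₂ e₃ hL y
  have he : ‖e₃‖ = 1 := by
    rw [he₃, EuclideanSpace.norm_eq]
    simp
  rw [he, mul_one] at hdev
  -- split the production
  have hsplit : ⟪Ω, D Ω⟫_ℝ = ⟪Ω, (D - (1 / L) • DI) Ω⟫_ℝ + (1 / L) * ⟪DI Ω, Ω⟫_ℝ := by
    rw [sub_apply, smul_apply, inner_sub_right, real_inner_smul_right,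
      real_inner_comm Ω (DI Ω)]
    ring
  rw [hsplit, hmean, mul_zero, add_zero]
  have hcs : ⟪Ω, (D - (1 / L) • DI) Ω⟫_ℝ ≤ ‖Ω‖ * ‖(D - (1 / L) • DI) Ω‖ := real_inner_le_norm _ _
  have hop : ‖(D - (1 / L) • DI) Ω‖ ≤ L * (C₃ / ((-s) * Real.sqrt (-s))) * ‖Ω‖ :=
    (ContinuousLinearMap.le_opNorm _ _).trans (mul_le_mul_of_nonneg_right hdev (norm_nonneg _))
  rw [real_inner_self_eq_norm_sq]
  calc ⟪Ω, (D - (1 / L) • DI) Ω⟫_ℝ ≤ ‖Ω‖ * ‖(D - (1 / L) • DI) Ω‖ := hcs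
    _ ≤ ‖Ω‖ * (L * (C₃ / ((-s) * Real.sqrt (-s))) * ‖Ω‖) := mul_le_mul_of_nonneg_left hop (norm_nonneg _)
    _ = L * C₃ / ((-s) * Real.sqrt (-s)) * ‖Ω‖ ^ 2 := by ring

/-- **VERTICALLY PERIODIC POLOIDAL PROFILES ARE IRROTATIONAL** (enstrophy Gronwall from `t = −∞` with the
integrable rate `L C₃ (−t)^{−3/2}` and the weight `g(t) = exp(−4LC₃/√(−t))`). -/
theorem curl_eq_zero_of_vertical_period (hrate : HasTypeITimeDecay C v)
    (hcont : ContinuousOn (uncurry v) (Iio (0 : ℝ) ×ˢ univ))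
    (hmild : ∀ s t : ℝ, s < t → t < 0 → ∀ x,
      v t x = UnboundedOperators.heatExtension (v s) (t - s) x - oseenDuhamel 1 s v v t x)
    (hdiv : ∀ t < 0, VectorCalculus.IsDivFree (v t))
    (hpol : ∀ s < 0, ∀ y, ⟪curl (v s) y, EuclideanSpace.single 2 (1 : ℝ)⟫_ℝ = 0)
    {L : ℝ} (hL : 0 < L) (hper : ∀ s < 0, ∀ y, v s (y + L • EuclideanSpace.single 2 (1 : ℝ)) = v s y) :
    ∀ t < 0, ∀ x, curl (v t) x = 0 := by
  obtain ⟨C₃, hC₃⟩ := exists_iteratedFDeriv_two_rate_of_class hrate hcont hmild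
  have hC₃0 : 0 ≤ C₃ := by
    have h := hC₃ (-1) (by norm_num) 0
    rw [neg_neg, Real.sqrt_one, mul_one, div_one] at h
    exact (norm_nonneg _).trans h
  set K : ℝ := L * C₃ with hK
  have hK0 : 0 ≤ K := mul_nonneg hL.le hC₃0
  -- the weight
  set g : ℝ → ℝ := fun t => Real.exp (-(4 * K) * (Real.sqrt (-t))⁻¹) with hgdef
  set g' : ℝ → ℝ := fun t => -(2 * K) / ((-t) * Real.sqrt (-t)) * g t with hg'def
  have hg : ∀ t < 0, HasDerivAt g (g' t) t := by
    intro t ht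
    have hnt : 0 < -t := neg_pos.2 ht
    have hsq : 0 < Real.sqrt (-t) := Real.sqrt_pos.2 hnt
    have h1 : HasDerivAt (fun τ : ℝ => Real.sqrt (-τ)) ((-1) / (2 * Real.sqrt (-t))) t :=
      (hasDerivAt_neg t).sqrt hnt.ne'
    have h2 : HasDerivAt (fun τ : ℝ => (Real.sqrt (-τ))⁻¹) (-((-1) / (2 * Real.sqrt (-t))) / Real.sqrt (-t) ^ 2) t :=
      h1.inv hsq.ne'
    have h3 : HasDerivAt (fun τ : ℝ => Real.exp (-(4 * K) * (Real.sqrt (-τ))⁻¹))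
        (Real.exp (-(4 * K) * (Real.sqrt (-t))⁻¹) *
          (-(4 * K) * (-((-1) / (2 * Real.sqrt (-t))) / Real.sqrt (-t) ^ 2))) t :=
      (h2.const_mul (-(4 * K))).exp
    refine h3.congr_deriv ?_
    simp only [hg'def, hgdef]
    rw [Real.sq_sqrt hnt.le]
    field_simp
    ring
  have hgpos : ∀ t < 0, 0 < g t := fun t _ => Real.exp_pos _
  have hgle : ∀ t, g t ≤ 1 := fun t => by
    simp only [hgdef]
    rw [Real.exp_le_one_iff]
    have : 0 ≤ (Real.sqrt (-t))⁻¹ := inv_nonneg.2 (Real.sqrt_nonneg _)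
    nlinarith
  have hglim : Tendsto (fun s => g s / s ^ 2) atBot (𝓝 0) := by
    have hup : Tendsto (fun s : ℝ => 1 / s ^ 2) atBot (𝓝 0) := by
      have h1 : Tendsto (fun s : ℝ => (-s) ^ 2) atBot atTop :=
        (tendsto_pow_atTop two_ne_zero).comp tendsto_neg_atBot_atTop
      have h2 : Tendsto (fun s : ℝ => s ^ 2) atBot atTop := h1.congr fun s => neg_sq s
      exact h2.inv_tendsto_atTop.congr fun s => by simp only [Pi.inv_apply, one_div]
    refine tendsto_of_tendsto_of_tendsto_of_le_of_le tendsto_const_nhds hup (fun s => ?_) (fun s => ?_)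
    · exact div_nonneg (Real.exp_pos _).le (sq_nonneg _)
    · exact div_le_div_of_nonneg_right (hgle s) (sq_nonneg _)
  have hprod2 : ∀ s < 0, ∀ y, 2 * g s * ⟪curl (v s) y, fderiv ℝ (v s) y (curl (v s) y)⟫_ℝ +
      g' s * ⟪curl (v s) y, curl (v s) y⟫_ℝ ≤ 0 := by
    intro s hs y
    have hP := production_le_of_vertical_period hrate hcont hmild hdiv hpol hL hper hC₃ hs y
    have hgs := hgpos s hs
    have hq : 0 ≤ ⟪curl (v s) y, curl (v s) y⟫_ℝ := real_inner_self_nonneg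
    simp only [hg'def]
    have h1 := mul_le_mul_of_nonneg_left hP hgs.le
    have e : -(2 * K) / (-s * Real.sqrt (-s)) * g s * ⟪curl (v s) y, curl (v s) y⟫_ℝ =
        -(2 * (g s * (L * C₃ / (-s * Real.sqrt (-s)) * ⟪curl (v s) y, curl (v s) y⟫_ℝ))) := by
      rw [hK]; ring
    rw [e]
    linarith
  exact PoloidalWindowDoorPoloidalWindowRigidityStrainRate.curl_eq_zero_of_weighted_production
    hrate hcont hmild hdiv hg hgpos hglim hprod2

/-- **THE VERTICALLY PERIODIC STRATUM OF THE RESIDUE IS EMPTY**: a poloidal profile of the route's Type-I class that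
is periodic in the vertical direction is identically zero. -/
theorem eq_zero_of_vertical_period (hrate : HasTypeITimeDecay C v)
    (hcont : ContinuousOn (uncurry v) (Iio (0 : ℝ) ×ˢ univ))
    (hmild : ∀ s t : ℝ, s < t → t < 0 → ∀ x,
      v t x = UnboundedOperators.heatExtension (v s) (t - s) x - oseenDuhamel 1 s v v t x)
    (hdiv : ∀ t < 0, VectorCalculus.IsDivFree (v t))
    (hpol : ∀ s < 0, ∀ y, ⟪curl (v s) y, EuclideanSpace.single 2 (1 : ℝ)⟫_ℝ = 0)
    {L : ℝ} (hL : 0 < L) (hper : ∀ s < 0, ∀ y, v s (y + L • EuclideanSpace.single 2 (1 : ℝ)) = v s y) :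
    ∀ t < 0, ∀ x, v t x = 0 :=
  eq_zero_of_irrotational hrate hcont hmild hdiv (curl_eq_zero_of_vertical_period hrate hcont hmild hdiv hpol hL hper)

/-- Stub currency: **a vertically periodic poloidal profile is not backward-singular.** -/
theorem nonflatLiouville_of_vertical_period (hrate : HasTypeITimeDecay C v)
    (hcont : ContinuousOn (uncurry v) (Iio (0 : ℝ) ×ˢ univ))
    (hmild : ∀ s t : ℝ, s < t → t < 0 → ∀ x,
      v t x = UnboundedOperators.heatExtension (v s) (t - s) x - oseenDuhamel 1 s v v t x)
    (hdiv : ∀ t < 0, VectorCalculus.IsDivFree (v t))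
    (hpol : ∀ s < 0, ∀ y, ⟪curl (v s) y, EuclideanSpace.single 2 (1 : ℝ)⟫_ℝ = 0)
    {L : ℝ} (hL : 0 < L) (hper : ∀ s < 0, ∀ y, v s (y + L • EuclideanSpace.single 2 (1 : ℝ)) = v s y) :
    ¬ IsBackwardSingularPoint v 0 :=
  nonflatLiouville_of_irrotational hrate hcont hmild hdiv
    (curl_eq_zero_of_vertical_period hrate hcont hmild hdiv hpol hL hper)

/-- **Vorticity version**: it suffices that the VORTICITY is vertically periodic on every slice (then so is the
velocity, by `…VorticityTranslate.periodic_of_curl_periodic` — bounded incompressible fields with periodic curl are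
periodic). -/
theorem eq_zero_of_curl_vertical_period (hrate : HasTypeITimeDecay C v)
    (hcont : ContinuousOn (uncurry v) (Iio (0 : ℝ) ×ˢ univ))
    (hmild : ∀ s t : ℝ, s < t → t < 0 → ∀ x,
      v t x = UnboundedOperators.heatExtension (v s) (t - s) x - oseenDuhamel 1 s v v t x)
    (hdiv : ∀ t < 0, VectorCalculus.IsDivFree (v t))
    (hpol : ∀ s < 0, ∀ y, ⟪curl (v s) y, EuclideanSpace.single 2 (1 : ℝ)⟫_ℝ = 0)
    {L : ℝ} (hL : 0 < L)
    (hper : ∀ s < 0, ∀ y, curl (v s) (y + L • EuclideanSpace.single 2 (1 : ℝ)) = curl (v s) y) :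
    ∀ t < 0, ∀ x, v t x = 0 := by
  refine eq_zero_of_vertical_period hrate hcont hmild hdiv hpol hL fun s hs => ?_
  have hsm : ContDiff ℝ 2 (v s) := (analyticOnNhd_slice hcont (bdd_of_hasTypeITimeDecay hrate) hmild hs).contDiff
  exact Summit.NavierStokesRegularity.NavierStokesRegularity.Theorems.PoloidalWindowDoorPoloidalWindowRigidityVorticityTranslate.periodic_of_curl_periodic
    hsm (hdiv s hs) (fun y => hrate s hs y) (hper s hs)

end Summit.NavierStokesRegularity.NavierStokesRegularity.Theorems.PoloidalWindowDoorPoloidalWindowRigidityVerticalPeriod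

end
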